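import Mathlib
import Summits.FinalStateConjecture.FinalStateConjecture.Theorems.EternalPapapetrouSchwarzschildExteriorModeRigidityVanishing
import Summits.FinalStateConjecture.FinalStateConjecture.Theorems.EternalPapapetrouSchwarzschildExteriorModeRigiditySmoothBounds
import Summits.FinalStateConjecture.FinalStateConjecture.Theorems.EternalPapapetrouSchwarzschildExteriorModeRigidityKernels2
import Literature.Analysis.Fourier.ConstOfFourierSupportZero
import HarnessLib

/-!
# Route EternalPapapetrou · SchwarzschildExteriorModeRigidity — the spectral step

Helper file for item stmt-FinalStateConjecture-10039 (`SchwarzschildExteriorModeRigidity`).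

From the vanishing of band-limited non-radiating jets (`RWJet.V_eq_zero`) we conclude that a
bounded `C²` solution `u` of the reduced `1+1` system with bounded first derivatives and
two-sided non-radiation `ρ ‖∂ₜu‖ → 0` is independent of `t` (`fderiv_time_eq_zero`):
mollify in time (`smoothJet`), band-limit with `ker R − ker ε` (`timeConvJet`, Bernstein data
`bernsteinData`) to get `ker R ⋆ u₁ = ker ε ⋆ u₁`; let `R → ∞` (approximate identity,
`tendsto_timeConv_ker`) and `ε → 0` (`translateDefect`, `eq_of_timeConv_ker_eq`); finally remove
the mollifier (`ContDiffBump.convolution_tendsto_right_of_continuous`). [folklore]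
-/

set_option linter.dupNamespace false

noncomputable section

namespace Summit.FinalStateConjecture.FinalStateConjecture.Theorems

open MeasureTheory Set Filter Topology Metric

namespace EternalPapapetrou.ModeRigidity

section General

variable {E : Type*} [NormedAddCommGroup E] [NormedSpace ℝ E] [CompleteSpace E]

omit [CompleteSpace E] in
/-- `timeConv` is additive in the kernel. [folklore] -/
theorem timeConv_sub_kernel {k₁ k₂ : ℝ → ℝ} {U : ℝ × ℝ → E} {p : ℝ × ℝ}
    (h₁ : Integrable fun s ↦ k₁ s • U (p.1 - s, p.2))
    (h₂ : Integrable fun s ↦ k₂ s • U (p.1 - s, p.2)) :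
    timeConv (fun s ↦ k₁ s - k₂ s) U p = timeConv k₁ U p - timeConv k₂ U p := by
  rw [timeConv_eq, timeConv_eq, timeConv_eq, ← integral_sub h₁ h₂]
  congr 1
  funext s
  rw [sub_smul]

/-- **Approximate identity**: `timeConv (ker n) U (t, r) → U (t, r)` as `n → ∞`, for a bounded
continuous slice `U(·, r)` (`∫ ker = 1`, `ker n = n · ker₁ (n ·)`, dominated convergence).
[folklore] -/
theorem tendsto_timeConv_ker {U : ℝ × ℝ → E} {t r : ℝ} (hUc : Continuous fun τ ↦ U (τ, r))
    {C : ℝ} (hUb : ∀ τ, ‖U (τ, r)‖ ≤ C) :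
    Tendsto (fun n : ℕ ↦ timeConv (ker (n + 1) (Nat.cast_add_one_pos n)) U (t, r)) atTop
      (𝓝 (U (t, r))) := by
  -- rescale: `timeConv (ker ρ) U (t, r) = ∫ ker₁ σ • U (t - σ / ρ, r) dσ`
  have key : ∀ (ρ : ℝ) (hρ : 0 < ρ), timeConv (ker ρ hρ) U (t, r) =
      ∫ σ, ker 1 one_pos σ • U (t - ρ⁻¹ * σ, r) := by
    intro ρ hρ
    rw [timeConv_eq]
    have h1 : ∀ s, ker ρ hρ s • U ((t, r).1 - s, (t, r).2) =
        ρ • (fun σ ↦ ker 1 one_pos σ • U (t - ρ⁻¹ * σ, r)) (ρ * s) := fun s ↦ by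
      simp only [ker_scaling ρ hρ s, smul_smul, ← mul_assoc, inv_mul_cancel₀ hρ.ne', one_mul]
    simp_rw [h1]
    rw [integral_smul, Measure.integral_comp_mul_left
      (fun σ ↦ ker 1 one_pos σ • U (t - ρ⁻¹ * σ, r)) ρ, abs_of_pos (inv_pos.2 hρ), smul_smul,
      mul_inv_cancel₀ hρ.ne', one_smul]
  have hUp : U (t, r) = ∫ σ, ker 1 one_pos σ • U (t, r) := by
    rw [integral_smul_const, integral_ker, one_smul]
  have hfun : (fun n : ℕ ↦ timeConv (ker (n + 1) (Nat.cast_add_one_pos n)) U (t, r)) =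
      fun n : ℕ ↦ ∫ σ, ker 1 one_pos σ • U (t - ((n : ℝ) + 1)⁻¹ * σ, r) :=
    funext fun n ↦ key _ _
  rw [hUp, hfun]
  have hk1 := integrable_ker 1 one_pos
  refine tendsto_integral_of_dominated_convergence (fun σ ↦ ‖ker 1 one_pos σ‖ * C)
    (fun n ↦ ?_) (hk1.norm.mul_const C) (fun n ↦ Eventually.of_forall fun σ ↦ ?_)
    (Eventually.of_forall fun σ ↦ ?_)
  · have hc : Continuous fun σ : ℝ ↦ U (t - ((n : ℝ) + 1)⁻¹ * σ, r) :=
      hUc.comp (continuous_const.sub (continuous_const.mul continuous_id))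
    exact ((continuous_ker 1 one_pos).smul hc).aestronglyMeasurable
  · rw [norm_smul]
    exact mul_le_mul_of_nonneg_left (hUb _) (norm_nonneg _)
  · have h0 : Tendsto (fun n : ℕ ↦ t - ((n : ℝ) + 1)⁻¹ * σ) atTop (𝓝 t) := by
      have h := (tendsto_const_nhds (x := t)).sub
        ((tendsto_one_div_add_atTop_nhds_zero_nat).mul_const σ)
      simp only [one_div, zero_mul, sub_zero] at h
      exact h
    exact ((hUc.tendsto t).comp h0).const_smul (ker 1 one_pos σ)

/-- `kerC ε` is the spread-out `kerC 1`. [folklore] -/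
theorem spreadKernel_kerC {ε : ℝ} (hε : 0 < ε) (x : ℝ) :
    Literature.Analysis.Fourier.spreadKernel (kerC 1 one_pos) ε x = kerC ε hε x := by
  rw [kerC_scaling ε hε x]
  simp [Literature.Analysis.Fourier.spreadKernel, Module.finrank_self]

/-- `L¹`-modulus of continuity of translations of `ker ε`, through `translateDefect`.
[folklore] -/
theorem integral_abs_ker_sub {ε : ℝ} (hε : 0 < ε) (v : ℝ) :
    ∫ s, |ker ε hε (s - v) - ker ε hε s| =
      Literature.Analysis.Fourier.translateDefect (kerC 1 one_pos) (ε • v) := by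
  rw [← Literature.Analysis.Fourier.integral_norm_spreadKernel_sub (kerC 1 one_pos) hε v]
  congr 1
  funext s
  rw [spreadKernel_kerC hε, spreadKernel_kerC hε, kerC_eq_ofReal, kerC_eq_ofReal,
    ← Complex.ofReal_sub, Complex.norm_real, Real.norm_eq_abs]

/-- **Constancy from scale invariance.** If `U(·, r)` is bounded and continuous and
`ker R ⋆ U = ker ε ⋆ U` for all `0 < ε ≤ R`, then `U(·, r)` is constant: letting `R → ∞`
gives `U = ker ε ⋆ U`, and `‖ker ε ⋆ U (t) − ker ε ⋆ U (t')‖ ≤ C ω(ε (t − t')) → 0` as `ε → 0`.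
[folklore] -/
theorem eq_of_timeConv_ker_eq {U : ℝ × ℝ → E} {r : ℝ} (hUc : Continuous fun τ ↦ U (τ, r))
    {C : ℝ} (hUb : ∀ τ, ‖U (τ, r)‖ ≤ C)
    (heq : ∀ (ε R : ℝ) (hε : 0 < ε) (hR : 0 < R), ε ≤ R →
      ∀ t, timeConv (ker R hR) U (t, r) = timeConv (ker ε hε) U (t, r)) (t t' : ℝ) :
    U (t, r) = U (t', r) := by
  -- Step 1: `U = ker ε ⋆ U`
  have h1 : ∀ (ε : ℝ) (hε : 0 < ε) (s : ℝ), U (s, r) = timeConv (ker ε hε) U (s, r) := by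
    intro ε hε s
    have hlim := tendsto_timeConv_ker (t := s) hUc hUb
    obtain ⟨N, hN⟩ := exists_nat_ge ε
    have hev : ∀ᶠ n : ℕ in atTop, timeConv (ker ε hε) U (s, r) =
        timeConv (ker (n + 1) (Nat.cast_add_one_pos n)) U (s, r) := by
      refine eventually_atTop.2 ⟨N, fun n hn ↦
        (heq ε (n + 1) hε (Nat.cast_add_one_pos n) ?_ s).symm⟩
      have : (N : ℝ) ≤ n := by exact_mod_cast hn
      linarith
    exact tendsto_nhds_unique hlim (tendsto_const_nhds.congr' hev)
  -- Step 2: the translation estimate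
  have h2 : ∀ (ε : ℝ) (hε : 0 < ε), ‖U (t, r) - U (t', r)‖ ≤
      C * Literature.Analysis.Fourier.translateDefect (kerC 1 one_pos) (ε • (t - t')) := by
    intro ε hε
    have hUc' : Continuous fun s ↦ U (t - s, r) := hUc.comp (continuous_const.sub continuous_id)
    have hI1 : Integrable fun s ↦ ker ε hε s • U (t - s, r) :=
      integrable_kernel_smul (integrable_ker ε hε) hUc' fun s _ ↦ hUb _
    have hI2 : Integrable fun s ↦ ker ε hε (s - (t - t')) • U (t - s, r) :=
      integrable_kernel_smul ((integrable_ker ε hε).comp_sub_right (t - t')) hUc' fun s _ ↦ hUb _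
    have hsub : timeConv (ker ε hε) U (t', r) = ∫ s, ker ε hε (s - (t - t')) • U (t - s, r) := by
      rw [timeConv_eq, ← integral_sub_right_eq_self
        (fun s ↦ ker ε hε s • U ((t', r).1 - s, (t', r).2)) (t - t')]
      refine integral_congr_ae (Eventually.of_forall fun s ↦ ?_)
      show ker ε hε (s - (t - t')) • U (t' - (s - (t - t')), r) = _
      rw [show t' - (s - (t - t')) = t - s by ring]
    have ht : timeConv (ker ε hε) U (t, r) = ∫ s, ker ε hε s • U (t - s, r) := timeConv_eq _ _ _
    rw [h1 ε hε t, h1 ε hε t', hsub, ht, ← integral_sub hI1 hI2]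
    calc ‖∫ s, (ker ε hε s • U (t - s, r) - ker ε hε (s - (t - t')) • U (t - s, r))‖
        ≤ ∫ s, ‖ker ε hε s • U (t - s, r) - ker ε hε (s - (t - t')) • U (t - s, r)‖ :=
          norm_integral_le_integral_norm _
      _ ≤ ∫ s, |ker ε hε (s - (t - t')) - ker ε hε s| * C := by
          refine integral_mono_of_nonneg (Eventually.of_forall fun s ↦ norm_nonneg _) ?_
            (Eventually.of_forall fun s ↦ ?_)
          · have := (((integrable_ker ε hε).comp_sub_right (t - t')).sub
              (integrable_ker ε hε)).norm.mul_const C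
            simpa only [Real.norm_eq_abs, Pi.sub_apply] using this
          · show ‖_‖ ≤ _
            rw [← sub_smul, norm_smul, Real.norm_eq_abs, abs_sub_comm]
            exact mul_le_mul_of_nonneg_left (hUb _) (abs_nonneg _)
      _ = C * Literature.Analysis.Fourier.translateDefect (kerC 1 one_pos) (ε • (t - t')) := by
          rw [integral_mul_const, integral_abs_ker_sub hε, mul_comm]
  -- Step 3: `ε → 0`
  have hlim : Tendsto (fun ε : ℝ ↦
      C * Literature.Analysis.Fourier.translateDefect (kerC 1 one_pos) (ε • (t - t')))
      (𝓝[>] 0) (𝓝 0) := by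
    have hε0 : Tendsto (fun ε : ℝ ↦ ε • (t - t')) (𝓝[>] 0) (𝓝 0) := by
      have : Tendsto (fun ε : ℝ ↦ ε • (t - t')) (𝓝 0) (𝓝 ((0 : ℝ) • (t - t'))) :=
        tendsto_id.smul tendsto_const_nhds
      rw [zero_smul] at this
      exact this.mono_left nhdsWithin_le_nhds
    have := ((Literature.Analysis.Fourier.tendsto_translateDefect (kerC 1 one_pos)).comp
      hε0).const_mul C
    rw [mul_zero] at this
    exact this
  have hle : ‖U (t, r) - U (t', r)‖ ≤ 0 :=
    le_of_tendsto_of_tendsto tendsto_const_nhds hlim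
      (eventually_nhdsWithin_of_forall fun ε hε ↦ h2 ε hε)
  exact sub_eq_zero.1 (norm_le_zero_iff.1 hle)

end General

/-! ### The jet-level statements (`E = ι → ℝ`) -/

section Jet

variable {ι : Type*} [Fintype ι] {M : ℝ} {Λ : (ι → ℝ) →L[ℝ] (ι → ℝ)}

/-- **Band-limited jets vanish**: for a jet `J₁` with global bounds on `V, Vt`, a radiation
bound and two-sided non-radiation, and `0 < ε ≤ R`, `timeConv (ker R − ker ε) J₁.V = 0` on the
strip (Bernstein via `bernsteinData`, then `RWJet.V_eq_zero`). [folklore] -/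
theorem timeConv_kerDiff_eq_zero (J₁ : RWJet M Λ) (B₁ : J₁.Bounds) (hM : 0 < M) {C₁ Crad : ℝ}
    (hb : ∀ p ∈ strip M, ‖J₁.V p‖ ≤ C₁ ∧ ‖J₁.Vt p‖ ≤ C₁)
    (hradB : ∀ p ∈ strip M, p.2 * ‖J₁.Vt p‖ ≤ Crad)
    (hrad : ∀ δ > (0 : ℝ), ∃ R₀, ∀ p ∈ strip M, R₀ ≤ p.2 → p.2 * ‖J₁.Vt p‖ ≤ δ)
    {ε R : ℝ} (hε : 0 < ε) (hR : 0 < R) (hεR : ε ≤ R) :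
    ∀ p ∈ strip M, timeConv (fun t ↦ ker R hR t - ker ε hε t) J₁.V p = 0 := by
  have h2M : 0 < 2 * M := by linarith
  obtain ⟨Θ, m, hΘi, hmi, hΘb, hΘd, hΘeq⟩ := bernsteinData hε hR hεR
  set k : ℝ → ℝ := fun t ↦ ker R hR t - ker ε hε t with hk_def
  have hk : Integrable k := (integrable_ker R hR).sub (integrable_ker ε hε)
  set J₂ := J₁.timeConvJet B₁ hk with hJ₂
  have hV2 : ∀ p, J₂.V p = timeConv k J₁.V p := fun p ↦ rfl
  have hVt2 : ∀ p, J₂.Vt p = timeConv k J₁.Vt p := fun p ↦ rfl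
  suffices h : ∀ t, ∀ ρ ∈ Ioi (2 * M), J₂.V (t, ρ) = 0 by
    intro p hp
    have := h p.1 p.2 hp.2
    rwa [Prod.mk.eta, hV2] at this
  set L := ∫ s, ‖k s‖ with hL
  have hL0 : 0 ≤ L := integral_nonneg fun s ↦ norm_nonneg _
  have hK0 : 0 ≤ ∫ s, ‖m s‖ := integral_nonneg fun s ↦ norm_nonneg _
  refine J₂.V_eq_zero hM (Crad := L * Crad) hK0 ?_ ?_ ?_
  · -- the inverse-Bernstein inequality
    intro ρ hρ b hbd t
    have hVb : ∀ τ, ‖J₁.V (τ, ρ)‖ ≤ C₁ := fun τ ↦ (hb (τ, ρ) ⟨mem_univ _, hρ⟩).1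
    have hVtb : ∀ τ, ‖J₁.Vt (τ, ρ)‖ ≤ C₁ := fun τ ↦ (hb (τ, ρ) ⟨mem_univ _, hρ⟩).2
    have step1 : J₂.V (t, ρ) = timeConv Θ J₁.Vt (t, ρ) := by
      rw [hV2]
      exact timeConv_deriv_kernel hΘi hk hΘd hΘb (p := (t, ρ))
        (fun τ ↦ J₁.hasDerivAt_V (p := (τ, ρ)) ⟨mem_univ _, hρ⟩)
        (RWJet.continuous_fixed_r J₁.continuousOn_t hρ) hVb hVtb
    have step2 : timeConv Θ J₁.Vt (t, ρ) = timeConv m J₂.Vt (t, ρ) := by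
      rw [hΘeq]
      exact (timeConv_timeConv hmi hk J₁.continuousOn_t (p := (t, ρ)) hρ hVtb).symm
    rw [step1, step2]
    exact norm_timeConv_le hmi hbd
  · -- the radiation bound
    intro t ρ hρ
    have hρ0 : 0 < ρ := lt_trans h2M hρ
    have hb' : ∀ τ, ‖J₁.Vt (τ, ρ)‖ ≤ Crad / ρ := fun τ ↦ by
      rw [le_div_iff₀ hρ0, mul_comm]; exact hradB (τ, ρ) ⟨mem_univ _, hρ⟩
    have := norm_timeConv_le hk hb' (p := (t, ρ)) (U := J₁.Vt)
    rw [hVt2]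
    calc ρ * ‖timeConv k J₁.Vt (t, ρ)‖ ≤ ρ * (L * (Crad / ρ)) := by gcongr
      _ = L * Crad := by field_simp
  · -- two-sided non-radiation
    intro δ hδ
    obtain ⟨R₀, hR₀⟩ := hrad (δ / (L + 1)) (by positivity)
    refine ⟨R₀, fun t ρ hR₀ρ hρ ↦ ?_⟩
    have hρ0 : 0 < ρ := lt_trans h2M hρ
    have hb' : ∀ τ, ‖J₁.Vt (τ, ρ)‖ ≤ δ / (L + 1) / ρ := fun τ ↦ by
      rw [le_div_iff₀ hρ0, mul_comm]; exact hR₀ (τ, ρ) ⟨mem_univ _, hρ⟩ hR₀ρ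
    have := norm_timeConv_le hk hb' (p := (t, ρ)) (U := J₁.Vt)
    rw [hVt2]
    calc ρ * ‖timeConv k J₁.Vt (t, ρ)‖ ≤ ρ * (L * (δ / (L + 1) / ρ)) := by gcongr
      _ = L / (L + 1) * δ := by field_simp
      _ ≤ 1 * δ := by
          gcongr
          rw [div_le_one (by positivity)]
          linarith
      _ = δ := one_mul δ

/-- **Mollified solutions are time independent**: for a jet `J₀` with global `C¹` bounds,
radiation bound and two-sided non-radiation, and a `C¹` compactly supported mollifier `k`,
`(k ⋆ₜ V)(·, r)` is constant for every `r > 2M`. [folklore] -/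
theorem smoothJet_V_const (J₀ : RWJet M Λ) (hM : 0 < M) {C₁ Crad : ℝ}
    (hb : ∀ p ∈ strip M, ‖J₀.V p‖ ≤ C₁ ∧ ‖J₀.Vt p‖ ≤ C₁ ∧ ‖J₀.Vr p‖ ≤ C₁)
    (hradB : ∀ p ∈ strip M, p.2 * ‖J₀.Vt p‖ ≤ Crad)
    (hrad : ∀ δ > (0 : ℝ), ∃ R₀, ∀ p ∈ strip M, R₀ ≤ p.2 → p.2 * ‖J₀.Vt p‖ ≤ δ)
    {k : ℝ → ℝ} (hk1 : ContDiff ℝ 1 k) (hks : HasCompactSupport k) {r : ℝ} (hr : r ∈ Ioi (2 * M))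
    (t t' : ℝ) :
    (J₀.smoothJet hk1.continuous hks).V (t, r) = (J₀.smoothJet hk1.continuous hks).V (t', r) := by
  have h2M : 0 < 2 * M := by linarith
  have hk : Integrable k := hk1.continuous.integrable_of_hasCompactSupport hks
  set J₁ := J₀.smoothJet hk1.continuous hks with hJ₁
  have B₁ : J₁.Bounds := J₀.smoothJetBounds hM hb hk1 hks
  set L := ∫ s, ‖k s‖ with hL
  have hL0 : 0 ≤ L := integral_nonneg fun s ↦ norm_nonneg _
  have hVt1 : ∀ p, J₁.Vt p = timeConv k J₀.Vt p := fun p ↦ rfl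
  have hb1 : ∀ p ∈ strip M, ‖J₁.V p‖ ≤ L * C₁ ∧ ‖J₁.Vt p‖ ≤ L * C₁ := by
    intro p hp
    have h := fun τ ↦ hb (τ, p.2) ⟨mem_univ _, hp.2⟩
    exact ⟨norm_timeConv_le hk fun τ ↦ (h τ).1, norm_timeConv_le hk fun τ ↦ (h τ).2.1⟩
  have hradB1 : ∀ p ∈ strip M, p.2 * ‖J₁.Vt p‖ ≤ L * Crad := by
    intro p hp
    have hρ0 : 0 < p.2 := lt_trans h2M hp.2
    have h : ∀ τ, ‖J₀.Vt (τ, p.2)‖ ≤ Crad / p.2 := fun τ ↦ by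
      rw [le_div_iff₀ hρ0, mul_comm]; exact hradB (τ, p.2) ⟨mem_univ _, hp.2⟩
    have := norm_timeConv_le hk h (U := J₀.Vt) (p := p)
    calc p.2 * ‖J₁.Vt p‖ ≤ p.2 * (L * (Crad / p.2)) := by rw [hVt1]; gcongr
      _ = L * Crad := by field_simp
  have hrad1 : ∀ δ > (0 : ℝ), ∃ R₀, ∀ p ∈ strip M, R₀ ≤ p.2 → p.2 * ‖J₁.Vt p‖ ≤ δ := by
    intro δ hδ
    obtain ⟨R₀, hR₀⟩ := hrad (δ / (L + 1)) (by positivity)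
    refine ⟨R₀, fun p hp hR₀p ↦ ?_⟩
    have hρ0 : 0 < p.2 := lt_trans h2M hp.2
    have h : ∀ τ, ‖J₀.Vt (τ, p.2)‖ ≤ δ / (L + 1) / p.2 := fun τ ↦ by
      rw [le_div_iff₀ hρ0, mul_comm]; exact hR₀ (τ, p.2) ⟨mem_univ _, hp.2⟩ hR₀p
    have := norm_timeConv_le hk h (U := J₀.Vt) (p := p)
    calc p.2 * ‖J₁.Vt p‖ ≤ p.2 * (L * (δ / (L + 1) / p.2)) := by rw [hVt1]; gcongr
      _ = L / (L + 1) * δ := by field_simp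
      _ ≤ 1 * δ := by
          gcongr
          rw [div_le_one (by positivity)]
          linarith
      _ = δ := one_mul δ
  -- scale invariance of `ker ρ ⋆ J₁.V`, then constancy
  have hUc : Continuous fun τ ↦ J₁.V (τ, r) := RWJet.continuous_fixed_r J₁.continuousOn hr
  have hUb : ∀ τ, ‖J₁.V (τ, r)‖ ≤ L * C₁ := fun τ ↦ (hb1 (τ, r) ⟨mem_univ _, hr⟩).1
  refine eq_of_timeConv_ker_eq hUc hUb (fun ε R hε hR hεR s ↦ ?_) t t'
  have hsr : ((s, r) : ℝ × ℝ) ∈ strip M := ⟨mem_univ _, hr⟩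
  have h0 := timeConv_kerDiff_eq_zero J₁ B₁ hM hb1 hradB1 hrad1 hε hR hεR (s, r) hsr
  have hint : ∀ (ρ : ℝ) (hρ : 0 < ρ),
      Integrable fun σ ↦ ker ρ hρ σ • J₁.V ((s, r).1 - σ, (s, r).2) := fun ρ hρ ↦
    integrable_kernel_smul (integrable_ker ρ hρ) (continuous_slice J₁.continuousOn s hr)
      fun σ _ ↦ hUb _
  rw [timeConv_sub_kernel (hint R hR) (hint ε hε), sub_eq_zero] at h0
  exact h0

/-- A sequence of bump functions shrinking to the Dirac mass. [folklore] -/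
def bumpSeq (n : ℕ) : ContDiffBump (0 : ℝ) :=
  ⟨((n : ℝ) + 2)⁻¹, ((n : ℝ) + 1)⁻¹, by positivity,
    inv_strictAnti₀ (by positivity) (by linarith)⟩

/-- The outer radii of `bumpSeq` tend to `0`. [folklore] -/
theorem tendsto_bumpSeq_rOut : Tendsto (fun n ↦ (bumpSeq n).rOut) atTop (𝓝 0) := by
  show Tendsto (fun n : ℕ ↦ ((n : ℝ) + 1)⁻¹) atTop (𝓝 0)
  simpa only [one_div] using tendsto_one_div_add_atTop_nhds_zero_nat (𝕜 := ℝ)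

/-- **Time independence of bounded non-radiating solutions of the reduced system.** A `C²`
solution `u` of the reduced system on the strip `r > 2M` (`0 < M`) with `u, ∂ₜu, ∂ᵣu` bounded
and `r ‖∂ₜu‖ → 0` as `r → ∞` uniformly in `t` satisfies `∂ₜ u = 0`. [folklore] -/
theorem fderiv_time_eq_zero (hM : 0 < M) (Λ : (ι → ℝ) →L[ℝ] (ι → ℝ)) (u : ℝ × ℝ → ι → ℝ)
    (hu : ContDiffOn ℝ 2 u (strip M))
    (hpde : ∀ p ∈ strip M, rwOp M Λ p.2 (u p) (fderiv ℝ u p e₁) (fderiv ℝ u p e₂)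
      (fderiv ℝ (fun q ↦ fderiv ℝ u q e₁) p e₁) (fderiv ℝ (fun q ↦ fderiv ℝ u q e₁) p e₂)
      (fderiv ℝ (fun q ↦ fderiv ℝ u q e₂) p e₂) = 0)
    {C₁ : ℝ} (hb : ∀ p ∈ strip M, ‖u p‖ ≤ C₁ ∧ ‖fderiv ℝ u p e₁‖ ≤ C₁ ∧ ‖fderiv ℝ u p e₂‖ ≤ C₁)
    (hrad : ∀ δ > (0 : ℝ), ∃ R₀, ∀ p ∈ strip M, R₀ ≤ p.2 → p.2 * ‖fderiv ℝ u p e₁‖ ≤ δ) :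
    ∀ p ∈ strip M, fderiv ℝ u p e₁ = 0 := by
  have h2M : 0 < 2 * M := by linarith
  set J₀ := RWJet.ofContDiff M Λ u hu hpde with hJ₀
  -- a global radiation constant
  obtain ⟨R₁, hR₁⟩ := hrad 1 one_pos
  have hradB : ∀ p ∈ strip M, p.2 * ‖J₀.Vt p‖ ≤ max 1 (|R₁| * C₁) := by
    intro p hp
    show p.2 * ‖fderiv ℝ u p e₁‖ ≤ _
    rcases le_or_gt R₁ p.2 with h | h
    · exact (hR₁ p hp h).trans (le_max_left _ _)
    · have hρ0 : 0 < p.2 := lt_trans h2M hp.2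
      have hC₁ : 0 ≤ C₁ := (norm_nonneg _).trans (hb p hp).1
      calc p.2 * ‖fderiv ℝ u p e₁‖ ≤ |R₁| * C₁ :=
            mul_le_mul (h.le.trans (le_abs_self R₁)) (hb p hp).2.1 (norm_nonneg _)
              (abs_nonneg _)
        _ ≤ max 1 (|R₁| * C₁) := le_max_right _ _
  have hb0 : ∀ p ∈ strip M, ‖J₀.V p‖ ≤ C₁ ∧ ‖J₀.Vt p‖ ≤ C₁ ∧ ‖J₀.Vr p‖ ≤ C₁ := hb
  have hrad0 : ∀ δ > (0 : ℝ), ∃ R₀, ∀ p ∈ strip M, R₀ ≤ p.2 → p.2 * ‖J₀.Vt p‖ ≤ δ := hrad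
  -- constancy in `t` of `u(·, r)`
  have hconst : ∀ r ∈ Ioi (2 * M), ∀ t t', u (t, r) = u (t', r) := by
    intro r hr t t'
    have hg : Continuous fun τ ↦ u (τ, r) := RWJet.continuous_fixed_r J₀.continuousOn hr
    have hlim : ∀ s, Tendsto (fun n ↦ (J₀.smoothJet (bumpSeq n).continuous_normed
        (bumpSeq n).hasCompactSupport_normed).V (s, r)) atTop (𝓝 (u (s, r))) := fun s ↦
      ContDiffBump.convolution_tendsto_right_of_continuous tendsto_bumpSeq_rOut hg s
    exact tendsto_nhds_unique (hlim t)
      ((hlim t').congr fun n ↦ (smoothJet_V_const J₀ hM hb0 hradB hrad0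
        (bumpSeq n).contDiff_normed (bumpSeq n).hasCompactSupport_normed hr t t').symm)
  intro p hp
  have hd : HasDerivAt (fun t ↦ u (t, p.2)) (fderiv ℝ u p e₁) p.1 := J₀.hasDerivAt_V hp
  have hc : (fun t ↦ u (t, p.2)) = fun _ ↦ u (0, p.2) := funext fun t ↦ hconst p.2 hp.2 t 0
  rw [hc] at hd
  exact hd.unique (hasDerivAt_const p.1 _)

end Jet

end EternalPapapetrou.ModeRigidity

end Summit.FinalStateConjecture.FinalStateConjecture.Theorems
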